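import Mathlib

/-!
# Route OverlapGapAlgebra, crux `SearchHardWindow` (stmt-PneNP-2460): the grand correlation
# inequality (Huang–Sellke 2025, Lemma 3.15 / Lemma 2.7, deterministic case, abstract form)

For a symmetric stochastic kernel `P` on a finite type `S` with the one-step positivity
`(Σ f)² ≤ #S · Σ_{y,y'} P y y' f y f y'`, a set `good ⊆ S` of density `≥ p` and a symmetric relation
`close` whose failure has one-step mass `≤ u · #S`, the paths `y : Fin (K+1) → S` of the `P`-Markov
chain (started from counting measure) that are good at all `K + 1` times and close at all `K` steps
have total mass `≥ #S · (p² − u)₊ ^ (2K)` for every `K ≥ 1` (`stub_grandCorrelation`, the engine of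
line `Sketch` of the crux: there `P` is the `ε`-resampling kernel on literal arrays, `good` = "the
low-degree algorithm solves the instance", `close` = "its output moves little").

Proof (Huang–Sellke 2025 §2.2 / §3.3, transfer-matrix form). With the symmetric substochastic matrix
`M a b = [good a] · P a b · [close a b] · [good b]` the path mass equals the total mass
`Σ_{a,b} (M ^ K) a b` (`gc_pathSum`: expansion of a path sum by induction on `K`, splitting off the
first vertex with `Fin.consEquiv`; `gc_summand`, `gc_absorb`). The total mass of `M ^ K` is antitone
in `K` (row sums `≤ 1`, `gc_total_mono`), satisfies the doubling inequality
`(Σ M^K)² ≤ #S · Σ M^{2K}` (Cauchy–Schwarz at the midpoint using symmetry, `gc_total_sq_le`), and at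
`K = 1` it is `≥ #S · (p² − u)` (positivity applied to the indicator of `good`, minus the
instability mass, `gc_base`); induction over powers of two (`gc_total_two_pow`) and
`K ≤ 2^j ≤ 2K` conclude (`gc_total_lower`).

References: B. Huang, M. Sellke, *Strong low degree hardness for stable local optima in spin
glasses*, arXiv:2501.06427 (2025), Lemma 2.7 and Lemma 3.15 [HuangSellke2025].
-/

set_option linter.dupNamespace false -- `Summit.PneNP.PneNP.…`: summit = sub-problem

namespace Summit.PneNP.PneNP.Theorems

open Finset
open scoped Classical

variable {S : Type*}

/-- Transfer-matrix expansion of a path sum: summing `D (y 0) · ∏ₜ M (y t) (y (t+1))` over all paths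
`y : Fin (K+1) → S` gives the `D`-weighted total mass `Σ_a D a · Σ_b (M ^ K) a b`. -/
theorem gc_pathSum [Fintype S] [DecidableEq S] (M : Matrix S S ℝ) :
    ∀ (K : ℕ) (D : S → ℝ),
      ∑ y : Fin (K + 1) → S, D (y 0) * ∏ t : Fin K, M (y t.castSucc) (y t.succ) =
        ∑ a, D a * ∑ b, (M ^ K) a b
  | 0, D => by
    rw [← (Equiv.funUnique (Fin 1) S).symm.sum_comp]
    simp [Matrix.one_apply]
  | K + 1, D => by
    rw [← (Fin.consEquiv fun _ : Fin (K + 1 + 1) => S).sum_comp, Fintype.sum_prod_type]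
    simp only [Fin.consEquiv_apply, Fin.prod_univ_succ, Fin.castSucc_zero, Fin.cons_zero,
      Fin.cons_succ, Fin.castSucc_succ]
    calc ∑ s, ∑ x : Fin (K + 1) → S, D s * (M s (x 0) * ∏ t : Fin K, M (x t.castSucc) (x t.succ))
        = ∑ x : Fin (K + 1) → S, (∑ s, D s * M s (x 0)) *
            ∏ t : Fin K, M (x t.castSucc) (x t.succ) := by
          rw [Finset.sum_comm]
          simp only [Finset.sum_mul, mul_assoc]
      _ = ∑ a, (∑ s, D s * M s a) * ∑ b, (M ^ K) a b :=
          gc_pathSum M K fun a => ∑ s, D s * M s a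
      _ = ∑ s, ∑ a, D s * (M s a * ∑ b, (M ^ K) a b) := by
          simp only [Finset.sum_mul, mul_assoc]
          rw [Finset.sum_comm]
      _ = ∑ s, D s * ∑ b, (M ^ (K + 1)) s b := by
          refine Finset.sum_congr rfl fun s _ => ?_
          rw [← Finset.mul_sum, pow_succ']
          congr 1
          simp only [Matrix.mul_apply, Finset.mul_sum]
          exact Finset.sum_comm

/-- Powers of an entrywise nonnegative matrix are entrywise nonnegative. -/
theorem gc_pow_nonneg [Fintype S] [DecidableEq S] (M : Matrix S S ℝ) (hM0 : ∀ a b, 0 ≤ M a b) :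
    ∀ (K : ℕ) (a b : S), 0 ≤ (M ^ K) a b
  | 0, a, b => by
    rw [pow_zero, Matrix.one_apply]
    split_ifs <;> norm_num
  | K + 1, a, b => by
    rw [pow_succ, Matrix.mul_apply]
    exact Finset.sum_nonneg fun c _ => mul_nonneg (gc_pow_nonneg M hM0 K a c) (hM0 c b)

/-- For a nonnegative matrix with row sums `≤ 1`, the total mass of `M ^ K` is antitone in `K`
(one step). -/
theorem gc_total_succ_le [Fintype S] [DecidableEq S] (M : Matrix S S ℝ) (hM0 : ∀ a b, 0 ≤ M a b)
    (hM1 : ∀ a, ∑ b, M a b ≤ 1) (K : ℕ) :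
    ∑ a, ∑ b, (M ^ (K + 1)) a b ≤ ∑ a, ∑ b, (M ^ K) a b := by
  refine Finset.sum_le_sum fun a _ => ?_
  calc ∑ b, (M ^ (K + 1)) a b = ∑ c, (M ^ K) a c * ∑ b, M c b := by
        simp only [pow_succ, Matrix.mul_apply, Finset.mul_sum]
        exact Finset.sum_comm
    _ ≤ ∑ c, (M ^ K) a c * 1 :=
        Finset.sum_le_sum fun c _ => mul_le_mul_of_nonneg_left (hM1 c) (gc_pow_nonneg M hM0 K a c)
    _ = ∑ c, (M ^ K) a c := by simp only [mul_one]

/-- For a nonnegative matrix with row sums `≤ 1`, the total mass of `M ^ K` is antitone in `K`. -/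
theorem gc_total_mono [Fintype S] [DecidableEq S] (M : Matrix S S ℝ) (hM0 : ∀ a b, 0 ≤ M a b)
    (hM1 : ∀ a, ∑ b, M a b ≤ 1) {K K' : ℕ} (h : K ≤ K') :
    ∑ a, ∑ b, (M ^ K') a b ≤ ∑ a, ∑ b, (M ^ K) a b :=
  antitone_nat_of_succ_le (f := fun L => ∑ a, ∑ b, (M ^ L) a b)
    (fun L => gc_total_succ_le M hM0 hM1 L) h

/-- Doubling by Cauchy–Schwarz at the midpoint: for a symmetric matrix,
`(Σ_{a,b} (M^K) a b)² ≤ #S · Σ_{a,b} (M^{2K}) a b`. -/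
theorem gc_total_sq_le [Fintype S] [DecidableEq S] (M : Matrix S S ℝ) (hM : M.IsSymm) (K : ℕ) :
    (∑ a, ∑ b, (M ^ K) a b) ^ 2 ≤ Fintype.card S * ∑ a, ∑ b, (M ^ (2 * K)) a b := by
  have hsymm : ∀ a c, (M ^ K) a c = (M ^ K) c a := fun a c => ((hM.pow K).apply a c).symm
  have key : ∑ a, ∑ b, (M ^ (2 * K)) a b = ∑ c, (∑ b, (M ^ K) c b) ^ 2 := by
    calc ∑ a, ∑ b, (M ^ (2 * K)) a b
        = ∑ a, ∑ c, ∑ b, (M ^ K) a c * (M ^ K) c b := by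
          simp only [two_mul, pow_add, Matrix.mul_apply]
          exact Finset.sum_congr rfl fun a _ => Finset.sum_comm
      _ = ∑ c, ∑ a, ∑ b, (M ^ K) a c * (M ^ K) c b := Finset.sum_comm
      _ = ∑ c, (∑ b, (M ^ K) c b) ^ 2 := by
          refine Finset.sum_congr rfl fun c _ => ?_
          rw [sq, Finset.sum_mul_sum]
          exact Finset.sum_congr rfl fun a _ => Finset.sum_congr rfl fun b _ => by rw [hsymm a c]
  calc (∑ a, ∑ b, (M ^ K) a b) ^ 2 ≤ #(univ : Finset S) * ∑ c, (∑ b, (M ^ K) c b) ^ 2 :=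
        sq_sum_le_card_mul_sum_sq
    _ = Fintype.card S * ∑ a, ∑ b, (M ^ (2 * K)) a b := by rw [Finset.card_univ, key]

/-- Induction over powers of two: if `M` is nonnegative and symmetric and its total mass is
`≥ #S · q` with `q ≥ 0`, then the total mass of `M ^ (2 ^ j)` is `≥ #S · q ^ (2 ^ j)`. -/
theorem gc_total_two_pow [Fintype S] [DecidableEq S] (M : Matrix S S ℝ) (hM0 : ∀ a b, 0 ≤ M a b)
    (hM : M.IsSymm) (hS : 0 < Fintype.card S) (q : ℝ) (hq : 0 ≤ q)
    (h1 : Fintype.card S * q ≤ ∑ a, ∑ b, M a b) :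
    ∀ j : ℕ, Fintype.card S * q ^ (2 ^ j) ≤ ∑ a, ∑ b, (M ^ (2 ^ j)) a b
  | 0 => by simpa using h1
  | j + 1 => by
    have ih := gc_total_two_pow M hM0 hM hS q hq h1 j
    have hsq := gc_total_sq_le M hM (2 ^ j)
    have hS' : (0 : ℝ) < Fintype.card S := Nat.cast_pos.mpr hS
    have hl : 0 ≤ (Fintype.card S : ℝ) * q ^ 2 ^ j := by positivity
    rw [pow_succ' 2 j, pow_mul']
    refine le_of_mul_le_mul_left ?_ hS'
    calc (Fintype.card S : ℝ) * (Fintype.card S * (q ^ 2 ^ j) ^ 2)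
        = (Fintype.card S * q ^ 2 ^ j) ^ 2 := by ring
      _ ≤ (∑ a, ∑ b, (M ^ (2 ^ j)) a b) ^ 2 := pow_le_pow_left₀ hl ih 2
      _ ≤ Fintype.card S * ∑ a, ∑ b, (M ^ (2 * 2 ^ j)) a b := hsq

/-- Every `K ≥ 1` lies in a dyadic window `K ≤ 2 ^ j ≤ 2K`. -/
theorem gc_exists_two_pow {K : ℕ} (hK : 1 ≤ K) : ∃ j : ℕ, K ≤ 2 ^ j ∧ 2 ^ j ≤ 2 * K :=
  ⟨Nat.log 2 K + 1, (Nat.lt_pow_succ_log_self one_lt_two K).le, by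
    rw [pow_succ']
    exact Nat.mul_le_mul_left 2 (Nat.pow_log_le_self 2 (by omega))⟩

/-- The matrix form of the grand correlation bound: for a nonnegative symmetric matrix with row
sums `≤ 1` whose total mass is `≥ #S · q` with `0 ≤ q ≤ 1`, the total mass of `M ^ K` is
`≥ #S · q ^ (2K)` for every `K ≥ 1`. -/
theorem gc_total_lower [Fintype S] [DecidableEq S] (M : Matrix S S ℝ) (hM0 : ∀ a b, 0 ≤ M a b)
    (hM1 : ∀ a, ∑ b, M a b ≤ 1) (hM : M.IsSymm) (hS : 0 < Fintype.card S) (q : ℝ) (hq : 0 ≤ q)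
    (hq1 : q ≤ 1) (h1 : Fintype.card S * q ≤ ∑ a, ∑ b, M a b) {K : ℕ} (hK : 1 ≤ K) :
    Fintype.card S * q ^ (2 * K) ≤ ∑ a, ∑ b, (M ^ K) a b := by
  obtain ⟨j, hKj, hjK⟩ := gc_exists_two_pow hK
  calc Fintype.card S * q ^ (2 * K) ≤ Fintype.card S * q ^ (2 ^ j) :=
        mul_le_mul_of_nonneg_left (pow_le_pow_of_le_one hq hq1 hjK) (Nat.cast_nonneg _)
    _ ≤ ∑ a, ∑ b, (M ^ (2 ^ j)) a b := gc_total_two_pow M hM0 hM hS q hq h1 j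
    _ ≤ ∑ a, ∑ b, (M ^ K) a b := gc_total_mono M hM0 hM1 hKj

/-- Absorption of an idempotent left weight: if `D a · M a b = M a b` for all `a, b`, then also
`D a · (M ^ K) a b = (M ^ K) a b` for `K ≥ 1`. -/
theorem gc_absorb [Fintype S] [DecidableEq S] (M : Matrix S S ℝ) (D : S → ℝ)
    (h : ∀ a b, D a * M a b = M a b) {K : ℕ} (hK : 1 ≤ K) (a b : S) :
    D a * (M ^ K) a b = (M ^ K) a b := by
  obtain ⟨K, rfl⟩ := Nat.exists_eq_add_of_le' hK
  rw [pow_succ', Matrix.mul_apply, Finset.mul_sum]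
  exact Finset.sum_congr rfl fun c _ => by rw [← mul_assoc, h]

/-- The summand of the grand correlation sum in transfer-matrix form: with
`M a b = [good a] · P a b · [close a b] · [good b]`, the weight of a path times the indicator of
"good everywhere and close at every step" is `[good (y 0)] · ∏ₜ M (y t) (y (t+1))`. -/
theorem gc_summand (P : S → S → ℝ) (good : S → Bool) (close : S → S → Bool) (M : Matrix S S ℝ)
    (hM : ∀ a b, M a b = (if good a = true then (1 : ℝ) else 0) * P a b *
      (if close a b = true then (1 : ℝ) else 0) * (if good b = true then (1 : ℝ) else 0))
    (K : ℕ) (y : Fin (K + 1) → S) :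
    (∏ t : Fin K, P (y t.castSucc) (y t.succ)) *
        (if (∀ t, good (y t) = true) ∧ (∀ t : Fin K, close (y t.castSucc) (y t.succ) = true)
          then (1 : ℝ) else 0) =
      (if good (y 0) = true then (1 : ℝ) else 0) * ∏ t : Fin K, M (y t.castSucc) (y t.succ) := by
  by_cases h : (∀ t, good (y t) = true) ∧ (∀ t : Fin K, close (y t.castSucc) (y t.succ) = true)
  · rw [if_pos h, if_pos (h.1 0), mul_one, one_mul]
    exact Finset.prod_congr rfl fun t _ => by rw [hM, h.1, h.1, h.2]; norm_num
  · rw [if_neg h, mul_zero]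
    rcases not_and_or.mp h with h1 | h1 <;> obtain ⟨t, ht⟩ := not_forall.mp h1
    · rcases Fin.eq_zero_or_eq_succ t with rfl | ⟨i, rfl⟩
      · rw [if_neg ht, zero_mul]
      · symm
        apply mul_eq_zero_of_right
        apply Finset.prod_eq_zero (Finset.mem_univ i)
        rw [hM]
        simp [ht]
    · symm
      apply mul_eq_zero_of_right
      apply Finset.prod_eq_zero (Finset.mem_univ t)
      rw [hM]
      simp [ht]

/-- The base case `K = 1`: positivity of `P` applied to the indicator of `good` (density `≥ p`)
minus the one-step instability mass `≤ u · #S` gives total mass `≥ #S · (p² − u)` for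
`M a b = [good a] · P a b · [close a b] · [good b]`. -/
theorem gc_base [Fintype S] (P : S → S → ℝ) (hP0 : ∀ y y', 0 ≤ P y y')
    (hPpos : ∀ f : S → ℝ, (∑ y, f y) ^ 2 ≤ Fintype.card S * ∑ y, ∑ y', P y y' * (f y * f y'))
    (good : S → Bool) (close : S → S → Bool) (p u : ℝ) (hp : 0 ≤ p)
    (hpS : p * Fintype.card S ≤ (univ.filter fun y => good y = true).card)
    (hu : ∑ y, ∑ y', P y y' * (if close y y' = true then (0 : ℝ) else 1) ≤ u * Fintype.card S)
    (hS : 0 < Fintype.card S) (M : Matrix S S ℝ)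
    (hM : ∀ a b, M a b = (if good a = true then (1 : ℝ) else 0) * P a b *
      (if close a b = true then (1 : ℝ) else 0) * (if good b = true then (1 : ℝ) else 0)) :
    Fintype.card S * (p ^ 2 - u) ≤ ∑ a, ∑ b, M a b := by
  have hS' : (0 : ℝ) < Fintype.card S := Nat.cast_pos.mpr hS
  have hsumD : ∑ a, (if good a = true then (1 : ℝ) else 0) =
      ((univ.filter fun y => good y = true).card : ℝ) := by
    rw [Finset.sum_boole]
  have hpos : (∑ a, (if good a = true then (1 : ℝ) else 0)) ^ 2 ≤
      Fintype.card S * ∑ a, ∑ b, P a b *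
        ((if good a = true then (1 : ℝ) else 0) * (if good b = true then (1 : ℝ) else 0)) :=
    hPpos _
  have h1 : Fintype.card S * p ^ 2 ≤ ∑ a, ∑ b, P a b *
      ((if good a = true then (1 : ℝ) else 0) * (if good b = true then (1 : ℝ) else 0)) := by
    refine le_of_mul_le_mul_left ?_ hS'
    calc (Fintype.card S : ℝ) * (Fintype.card S * p ^ 2) = (p * Fintype.card S) ^ 2 := by ring
      _ ≤ (∑ a, (if good a = true then (1 : ℝ) else 0)) ^ 2 := by
          rw [hsumD]
          exact pow_le_pow_left₀ (by positivity) hpS 2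
      _ ≤ _ := hpos
  have h2 : ∀ a b, P a b * ((if good a = true then (1 : ℝ) else 0) *
      (if good b = true then (1 : ℝ) else 0)) - P a b * (if close a b = true then (0 : ℝ) else 1)
        ≤ M a b := by
    intro a b
    rw [hM]
    have := hP0 a b
    split_ifs <;> linarith
  calc Fintype.card S * (p ^ 2 - u) = Fintype.card S * p ^ 2 - u * Fintype.card S := by ring
    _ ≤ (∑ a, ∑ b, P a b * ((if good a = true then (1 : ℝ) else 0) *
          (if good b = true then (1 : ℝ) else 0))) -
          ∑ a, ∑ b, P a b * (if close a b = true then (0 : ℝ) else 1) := sub_le_sub h1 hu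
    _ = ∑ a, ∑ b, (P a b * ((if good a = true then (1 : ℝ) else 0) *
          (if good b = true then (1 : ℝ) else 0)) -
          P a b * (if close a b = true then (0 : ℝ) else 1)) := by
        simp only [Finset.sum_sub_distrib]
    _ ≤ ∑ a, ∑ b, M a b := Finset.sum_le_sum fun a _ => Finset.sum_le_sum fun b _ => h2 a b

/-- **Grand correlation inequality** (Huang–Sellke 2025, Lemma 3.15 / Lemma 2.7, deterministic
case, abstract form). For a symmetric stochastic kernel `P` on a finite type with the one-step
positivity `(Σ f)² ≤ #S · Σ P f f`, a set `good` of density `≥ p` and a symmetric relation `close`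
failing with one-step mass `≤ u · #S`: the paths of length `K ≥ 1` that are good at every time and
close at every step have mass `≥ #S · (p² − u)₊ ^ (2K)`. -/
theorem stub_grandCorrelation {S : Type*} [Fintype S] [DecidableEq S]
    (P : S → S → ℝ) (hP0 : ∀ y y', 0 ≤ P y y') (hPsymm : ∀ y y', P y y' = P y' y)
    (hPstoch : ∀ y, ∑ y', P y y' = 1)
    (hPpos : ∀ f : S → ℝ, (∑ y, f y) ^ 2 ≤ Fintype.card S * ∑ y, ∑ y', P y y' * (f y * f y'))
    (good : S → Bool) (close : S → S → Bool) (hclose : ∀ y y', close y y' = close y' y)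
    (p u : ℝ) (hp : 0 ≤ p) (hpS : p * Fintype.card S ≤ (univ.filter fun y => good y = true).card)
    (hu : ∑ y, ∑ y', P y y' * (if close y y' = true then (0 : ℝ) else 1) ≤ u * Fintype.card S)
    (K : ℕ) (hK : 1 ≤ K) :
    Fintype.card S * (max 0 (p ^ 2 - u)) ^ (2 * K) ≤
      ∑ y : Fin (K + 1) → S, (∏ t : Fin K, P (y t.castSucc) (y t.succ)) *
        (if (∀ t, good (y t) = true) ∧ (∀ t : Fin K, close (y t.castSucc) (y t.succ) = true)
          then (1 : ℝ) else 0) := by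
  rcases Nat.eq_zero_or_pos (Fintype.card S) with hS0 | hS
  · rw [hS0, Nat.cast_zero, zero_mul]
    refine Finset.sum_nonneg fun y _ => mul_nonneg (Finset.prod_nonneg fun t _ => hP0 _ _) ?_
    split_ifs <;> norm_num
  -- the transfer matrix `M a b = [good a] · P a b · [close a b] · [good b]`
  obtain ⟨M, hM⟩ : ∃ M : Matrix S S ℝ, ∀ a b, M a b = (if good a = true then (1 : ℝ) else 0) *
      P a b * (if close a b = true then (1 : ℝ) else 0) * (if good b = true then (1 : ℝ) else 0) :=
    ⟨Matrix.of fun a b => (if good a = true then (1 : ℝ) else 0) * P a b *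
      (if close a b = true then (1 : ℝ) else 0) * (if good b = true then (1 : ℝ) else 0),
      fun _ _ => rfl⟩
  have hM0 : ∀ a b, 0 ≤ M a b := by
    intro a b
    rw [hM]
    have := hP0 a b
    split_ifs <;> linarith
  have hM1 : ∀ a, ∑ b, M a b ≤ 1 := by
    intro a
    rw [← hPstoch a]
    refine Finset.sum_le_sum fun b _ => ?_
    rw [hM]
    have := hP0 a b
    split_ifs <;> linarith
  have hMsymm : M.IsSymm := Matrix.IsSymm.ext fun a b => by
    rw [hM, hM, hPsymm b a, hclose b a]
    ring
  have habs : ∀ a b, (if good a = true then (1 : ℝ) else 0) * M a b = M a b := by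
    intro a b
    rw [hM]
    split_ifs <;> ring
  have hS' : (0 : ℝ) < Fintype.card S := Nat.cast_pos.mpr hS
  -- the path sum is the total mass of `M ^ K`
  have hRHS : ∑ y : Fin (K + 1) → S, (∏ t : Fin K, P (y t.castSucc) (y t.succ)) *
      (if (∀ t, good (y t) = true) ∧ (∀ t : Fin K, close (y t.castSucc) (y t.succ) = true)
        then (1 : ℝ) else 0) = ∑ a, ∑ b, (M ^ K) a b := by
    calc _ = ∑ y : Fin (K + 1) → S, (if good (y 0) = true then (1 : ℝ) else 0) *
          ∏ t : Fin K, M (y t.castSucc) (y t.succ) :=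
          Finset.sum_congr rfl fun y _ => gc_summand P good close M hM K y
      _ = ∑ a, (if good a = true then (1 : ℝ) else 0) * ∑ b, (M ^ K) a b :=
          gc_pathSum M K fun a => if good a = true then (1 : ℝ) else 0
      _ = ∑ a, ∑ b, (M ^ K) a b := by
          refine Finset.sum_congr rfl fun a _ => ?_
          rw [Finset.mul_sum]
          exact Finset.sum_congr rfl fun b _ => gc_absorb M _ habs hK a b
  rw [hRHS]
  -- the parameter `q = (p² − u)₊ ∈ [0, 1]`
  have hp1 : p ≤ 1 := by
    refine le_of_mul_le_mul_right ?_ hS'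
    rw [one_mul]
    refine hpS.trans ?_
    rw [← Finset.card_univ]
    exact_mod_cast Finset.card_filter_le _ _
  have hu0 : 0 ≤ u := by
    refine le_of_mul_le_mul_right ?_ hS'
    rw [zero_mul]
    refine le_trans (Finset.sum_nonneg fun a _ => Finset.sum_nonneg fun b _ => ?_) hu
    have := hP0 a b
    split_ifs <;> linarith
  have hq0 : 0 ≤ max 0 (p ^ 2 - u) := le_max_left _ _
  have hq1 : max 0 (p ^ 2 - u) ≤ 1 := max_le zero_le_one (by nlinarith)
  have h1 : Fintype.card S * max 0 (p ^ 2 - u) ≤ ∑ a, ∑ b, M a b := by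
    rcases le_total (p ^ 2 - u) 0 with h | h
    · rw [max_eq_left h, mul_zero]
      exact Finset.sum_nonneg fun a _ => Finset.sum_nonneg fun b _ => hM0 a b
    · rw [max_eq_right h]
      exact gc_base P hP0 hPpos good close p u hp hpS hu hS M hM
  exact gc_total_lower M hM0 hM1 hMsymm hS _ hq0 hq1 h1 hK

end Summit.PneNP.PneNP.Theorems
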